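import Literature.AnabelianGeometry.EtaleTheta.ArithThetaTowerDivisorMonoids
import HarnessLib

/-!
# [EtTh] Def. 3.3 (iii) / Prop. 3.4 (ii) for the ARITHMETIC theta tower (GAP A, item GA-02), engine LAWS: the (ii)-hull inclusion
# `constDivIncl` of the constants' divisors BY NAME, Prop. 3.4 (ii) «trivial divisor ⇒ constant» at the engine, and the recorded
# residual `SpecialFibreCoupling` (RULINGS #334 (2) (a)(b)(c))

S. Mochizuki, *The étale theta function …*, Publ. RIMS **45** (2009) [MochizukiEtTh2009], §3, Def. 3.3 (iii) PRIMS PDF p.73 (`Φ₀`, `B₀`,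
`B₀ → Φ₀^gp`, `F₀`, `Φ₀^cnst ⊆ Φ₀^gp` «the image of `F₀`»), Prop. 3.4 (ii) p.74 («`O_L^× ≅ Ker(B₀(Y^log) → Φ₀^gp(Y^log))` …
`L^× ≅ F₀(Y^log)`») [cite: MochizukiEtTh2009, Prop 3.4 p.74]; [IUTchI] Ex. 3.2 (ii)/(iv) p.70–71 (the base-field-theoretic hull `𝒞_v`,
`Φ^cnst ⊆ Φ`, `𝒞⊢_v`) [claim: Mochizuki2012, status: disputed — nothing of the series is asserted]; [FrdII] Ex. 1.1 (i) p.7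
[cite: MochizukiFrdII2008, Ex 1.1 (i) p.7].

abc-iut cell, GAP A = G-L5-EX32I-1, item **GA-02** (chair's `plan/L5/GAP-A-SIGNATURES.md` v1 e3ccddf9b87597cf §2; **RULINGS #334 (2)**: the
direct-sum type `Φ₀(U) = ord(𝒪^▷_{Ω^{aug U}}) × Φ₀^geom(U)` is «ACCEPTED AS THE TYPE, LABELLED» under three conditions — (a) the
«⊕-DECOUPLED» sentence (here and on the ruled decl), (b) the (ii)-hull inclusion of the constants' divisors as a NAMED monoid map with its
naturality, (c) the statement-only residual `SpecialFibreCoupling`), seat abc-iut-gapA-02-divisorMonoids.  PROOF/PLUMBING file over THIS seat's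
engine `divisorMonoidsOf d T A hZ` (`ArithThetaTowerDivisorMonoids.lean`, ★ p667325) and `DivisorMonoids.prod` (`ArithThetaTowerPrelim.lean`,
★ p666726); abc-iut-w6-d058's `divZeroHom_eq_div_iff` / `fZero` and the frozen interface fields `LogDivisorModel.divisor_eq_one_iff` /
`intConst` are consumed BY NAME.

⊕-DECOUPLED (RULINGS #334 (2)(a), verbatim label): «the print identification div(ϖ_U) = Σ special-fibre components is NOT imposed at the decreed
avatar; constants' divisors = the genuine value monoid `OrdInt` ([FrdII] Ex 1.1 (i)); geometric divisors = the envelope; coupling deferred with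
FOUNDATIONS 13».

WHAT IS HERE (every `theorem` PROVED; two `def`s):
* `gpMap_one_hom`, `DivisorMonoids.prodDiv₀_fst/_snd/_eq_one_iff`, `prod_div₀_eq_one_iff`, `prod_ker_div₀_le_F₀` — the divisor of the product data projects to the
  factors' divisors; Prop. 3.4 (ii) «`Ker(B₀ → Φ₀^gp) ⊆ F₀`» holds for a product iff for both factors.
* `LogDivisorModel.GaloisAction.bZero_eq_one_of_divZeroHom_eq_one` — for a log-divisor model WITHOUT integral constants (`intConst = ⊥`, as the
  decreed theta envelopes of GA-10 `Envelope.model` and of `ArithThetaTowerEnvelope.lean`), an equivariant family of log-meromorphic functions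
  with trivial «log-divisor of zeroes and poles» is trivial; hence `ker_divZeroHom_le_fZero`.
* **`ArithThetaTower.constDivInclOf d T A hZ U : ord(𝒪^▷_{Ω^{aug U}}) →* Φ₀(U)`** (#334 (2)(b); = `MonoidHom.inl`, the constants are the FIRST
  factor of the engine) with `constDivInclOf_injective`, **`constDivInclOf_natural`** (along every `f : U → V` of `𝒟_v̲` it intertwines the
  genuine restriction `ordIntMapOfHom (fixedHom)` with `Φ₀.map f`), and **`div₀_const`**: the divisor of a genuine constant `c ∈ (Ω^{aug U})^×` IS
  its valuation read through `constDivInclOf` — so the base-field-theoretic hull `𝒞⊢` ([IUTchI] Ex 3.2 (ii)/(iv)) and GA-03's realification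
  read the constants' divisors BY NAME, never by projection folklore.
* **`ArithThetaTower.divisorMonoidsOf_ker_div₀_le_F₀_of_intConst_eq_bot`** — Prop. 3.4 (ii), first clause, AT THE ENGINE for every geometric
  model with `intConst = ⊥`: `div₀ b = 1 ⇒ b ∈ F₀(U)` (the GAP-row binder `hP34`-style clause is a THEOREM here, not a hypothesis).
* **`ArithThetaTower.SpecialFibreCouplingOf d T A hZ : Prop`** (#334 (2)(c); STATEMENT ONLY, no proof owed or claimed): «there is a
  `Π`-compatible special fibre `F_U ∈ Φ₀^geom(U)` (non-cuspidal, non-trivial, pulled back to itself) and normalised valuations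
  `ord_U : ord(𝒪^▷_{Ω^{aug U}}) ≅ ℕ` with ramification indices `e_U ≥ 1` satisfying `ord_V(x|_V)·e_U = ord_U(x)·e_V` — i.e. the data under
  which `[x] ↦ F_U^{ord_U(x)/e_U}` identifies the constants' divisors with rational multiples of the special fibre in `Φ₀^geom(U)^pf`, natural
  in `U`» — the residual a future (infinite-tower / stable-model) build would discharge to recover print's COUPLED `Φ₀`; the amalgamated sum
  `(ord(𝒪^▷) ⊕ Φ₀^geom)/⟨([ϖ_U], F_U^{−1/e_U})⟩` is then print's monoid.  Nothing downstream may use the decoupling to trivialise a law (#334 (2)).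

No `Prop`-valued FACT (the one `Prop`-valued `def` is the chair-ordered residual STATEMENT, bound by no theorem here), no instance, no notation,
no sorry.  HONEST FRAMING: laws over typed interfaces; no side taken on [IUTchIII] Cor. 3.12 (undisputed construction around it); typed ≠
inhabited ≠ proved-in-print; count-neutral; NO abc claim.
-/

noncomputable section

namespace Literature.AnabelianGeometry.EtaleTheta

open CategoryTheory Opposite Function Literature.AlgebraicGeometry.Frobenioids
  Literature.AlgebraicGeometry.Frobenioids.PadicFrd Literature.AnabelianGeometry.SemiGraphs Literature.IUT.HodgeTheaters
  LogDivisorModel LogDivisorModel.GaloisAction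

universe u v w

/-! ## §1 Projections of the product divisor map -/

/-- The groupification of the trivial homomorphism is trivial. [cite: MochizukiEtTh2009, Def 3.3 p.73] -/
theorem gpMap_one_hom {M N : Type w} [CommMonoid M] [CommMonoid N] : gpMap (1 : M →* N) = 1 := by
  have h : (Algebra.GrothendieckGroup.lift).symm (1 : Algebra.GrothendieckGroup M →* Algebra.GrothendieckGroup N) = 1 := by
    rw [Algebra.GrothendieckGroup.lift_symm_apply, MonoidHom.one_comp]
  have h' : Algebra.GrothendieckGroup.lift (1 : M →* Algebra.GrothendieckGroup N) =
      (1 : Algebra.GrothendieckGroup M →* Algebra.GrothendieckGroup N) := by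
    rw [← h, Equiv.apply_symm_apply]
  change Algebra.GrothendieckGroup.lift (Algebra.GrothendieckGroup.of.comp (1 : M →* N)) = 1
  rw [MonoidHom.comp_one]
  exact h'

/-- The groupification of the identity is the identity, on elements. [cite: MochizukiEtTh2009, Def 3.3 p.73] -/
theorem gpMap_id_apply {M : Type w} [CommMonoid M] (x : Algebra.GrothendieckGroup M) : gpMap (MonoidHom.id M) x = x := by
  rw [gpMap_eq_monGpMap, MonGp.map_id]
  rfl

namespace DivisorMonoids

variable {D₀ : Type u} [Category.{v} D₀] (T₁ T₂ : DivisorMonoids.{u, v, w} D₀)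

/-- The first projection of the product's divisor is the first factor's divisor. [cite: MochizukiEtTh2009, Def 3.3 p.73] -/
theorem prodDiv₀_fst (Y : D₀ᵒᵖ) (b : T₁.B₀.obj Y × T₂.B₀.obj Y) :
    gpMap (MonoidHom.fst (T₁.Φ₀.obj Y) (T₂.Φ₀.obj Y)) (prodDiv₀ T₁ T₂ Y b) = T₁.div₀ Y b.1 := by
  rw [prodDiv₀_apply, map_mul, ← gpMap_comp_apply'', ← gpMap_comp_apply'', MonoidHom.fst_comp_inl, MonoidHom.fst_comp_inr,
    gpMap_id_apply, gpMap_one_hom, MonoidHom.one_apply, mul_one]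

/-- The second projection of the product's divisor is the second factor's divisor. [cite: MochizukiEtTh2009, Def 3.3 p.73] -/
theorem prodDiv₀_snd (Y : D₀ᵒᵖ) (b : T₁.B₀.obj Y × T₂.B₀.obj Y) :
    gpMap (MonoidHom.snd (T₁.Φ₀.obj Y) (T₂.Φ₀.obj Y)) (prodDiv₀ T₁ T₂ Y b) = T₂.div₀ Y b.2 := by
  rw [prodDiv₀_apply, map_mul, ← gpMap_comp_apply'', ← gpMap_comp_apply'', MonoidHom.snd_comp_inl, MonoidHom.snd_comp_inr,
    gpMap_id_apply, gpMap_one_hom, MonoidHom.one_apply, one_mul]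

/-- The product's divisor map is trivial on `b` iff both factors' divisors are. [cite: MochizukiEtTh2009, Def 3.3 p.73] -/
theorem prodDiv₀_eq_one_iff (Y : D₀ᵒᵖ) (b : T₁.B₀.obj Y × T₂.B₀.obj Y) :
    prodDiv₀ T₁ T₂ Y b = 1 ↔ T₁.div₀ Y b.1 = 1 ∧ T₂.div₀ Y b.2 = 1 := by
  constructor
  · intro h
    exact ⟨by rw [← prodDiv₀_fst T₁ T₂ Y b, h, map_one], by rw [← prodDiv₀_snd T₁ T₂ Y b, h, map_one]⟩
  · rintro ⟨h₁, h₂⟩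
    rw [prodDiv₀_apply, h₁, h₂, map_one, map_one, one_mul]

/-- **The product's divisor is trivial iff both factors' divisors are** (the `DivisorMonoids.prod` form). [cite: MochizukiEtTh2009, Def 3.3 p.73] -/
theorem prod_div₀_eq_one_iff (Y : D₀ᵒᵖ) (b : T₁.B₀.obj Y × T₂.B₀.obj Y) :
    (T₁.prod T₂).div₀ Y b = 1 ↔ T₁.div₀ Y b.1 = 1 ∧ T₂.div₀ Y b.2 = 1 :=
  prodDiv₀_eq_one_iff T₁ T₂ Y b

/-- **Prop. 3.4 (ii), first clause («a log-meromorphic function with trivial divisor is constant»), is product-stable**: it holds for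
`T₁.prod T₂` as soon as it holds for both factors. [cite: MochizukiEtTh2009, Prop 3.4 p.74] -/
theorem prod_ker_div₀_le_F₀ (h₁ : ∀ (Y : D₀ᵒᵖ) (b : T₁.B₀.obj Y), T₁.div₀ Y b = 1 → b ∈ T₁.F₀ Y)
    (h₂ : ∀ (Y : D₀ᵒᵖ) (b : T₂.B₀.obj Y), T₂.div₀ Y b = 1 → b ∈ T₂.F₀ Y) (Y : D₀ᵒᵖ) (b : T₁.B₀.obj Y × T₂.B₀.obj Y)
    (hb : (T₁.prod T₂).div₀ Y b = 1) : b ∈ (T₁.prod T₂).F₀ Y := by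
  rw [prod_div₀_eq_one_iff] at hb
  exact ⟨h₁ Y b.1 hb.1, h₂ Y b.2 hb.2⟩

end DivisorMonoids

/-! ## §2 Log-divisor models without integral constants: trivial divisor ⇒ trivial function -/

namespace LogDivisorModel.GaloisAction

variable {Z : LogDivisorModel.{u}} {G : Type u} [Group G] (A : Z.GaloisAction G)

/-- For a log-divisor model with NO integral constants (`𝒪^▷ = 1`: the decreed, constant-free theta envelopes), a log-meromorphic
function with trivial divisor is trivial (Prop. 3.2 (ii) / `divisor_eq_one_iff` of the interface). [cite: MochizukiEtTh2009, Prop 3.2 p.70] -/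
theorem logMero_eq_one_of_divisor_eq_one (hZi : Z.intConst = ⊥) (f : Z.logMero) (hf : Z.divisor f = 1) : f = 1 := by
  have h := (Z.divisor_eq_one_iff f).1 hf
  rw [hZi] at h
  exact Subtype.ext (Submonoid.mem_bot.mp h.1)

/-- **For `𝒪^▷ = 1`, an equivariant family with trivial «log-divisor of zeroes and poles» is trivial.** [cite: MochizukiEtTh2009, Prop 3.4 p.74] -/
theorem bZero_eq_one_of_divZeroHom_eq_one (hZi : Z.intConst = ⊥) (S : Action (Type u) G) (b : A.bZero S)
    (hb : A.divZeroHom S b = 1) : b = 1 := by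
  have hb' : A.divZeroHom S b = Algebra.GrothendieckGroup.of (1 : A.phiZero S) / Algebra.GrothendieckGroup.of 1 := by
    rw [hb, map_one, div_one]
  have h := (A.divZeroHom_eq_div_iff S b 1 1).1 hb'
  refine Subtype.ext (funext fun s => ?_)
  have hs : A.divAt S b s = 1 := by
    have := h s
    rw [Submonoid.coe_one, Pi.one_apply, mul_one] at this
    exact this
  have hf : (⟨b.1 s, b.2.1 s⟩ : Z.logMero) = 1 := logMero_eq_one_of_divisor_eq_one hZi _ hs
  exact congrArg Subtype.val hf

/-- **Prop. 3.4 (ii), first clause, for `𝒪^▷ = 1`**: `Ker(B₀(S) → Φ₀(S)^gp) ⊆ F₀(S)` (indeed `= 1`). [cite: MochizukiEtTh2009, Prop 3.4 p.74] -/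
theorem ker_divZeroHom_le_fZero (hZi : Z.intConst = ⊥) (S : Action (Type u) G) (b : A.bZero S) (hb : A.divZeroHom S b = 1) :
    b ∈ A.fZero S := by
  rw [bZero_eq_one_of_divZeroHom_eq_one A hZi S b hb]
  exact Submonoid.one_mem _

end LogDivisorModel.GaloisAction

/-! ## §3 The engine: `constDivIncl` BY NAME, Prop. 3.4 (ii) at the engine, and the residual `SpecialFibreCoupling` -/

namespace ArithThetaTower

variable {p : ℕ} [Fact p.Prime] (d : GaloisValDatum.{0} p) {P : Type} [Group P] [TopologicalSpace P]
  (T : BadLocalGroupDatum d.Gal P) {Z : LogDivisorModel.{0}} (A : Z.GaloisAction P) (hZ : Z.CuspLaws)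

/-- **The (ii)-hull inclusion of the constants' divisors** (RULINGS #334 (2)(b)): `ord(𝒪^▷_{Ω^{aug U}}) →* Φ₀(U) = ord(𝒪^▷_{Ω^{aug U}}) ×
Φ₀^geom(U)`, `x ↦ (x, 1)` — «`Φ₀^cnst ⊆ Φ₀^gp`» of Def. 3.3 (iii) / the constant part `Φ_{𝒞⊢_v}` of [IUTchI] Ex. 3.2 (iv), BY NAME.
[cite: MochizukiEtTh2009, Def 3.3 p.73] -/
def constDivInclOf (U : T.Dvᵒᵖ) :
    OrdInt (constFld d T U.unop).K →* (OrdInt (constFld d T U.unop).K × A.phiZero ((cosetGSetFunctor P).obj U.unop)) :=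
  MonoidHom.inl _ _

/-- `constDivInclOf` lands in `Φ₀(U)` of the engine (same type, definitionally). [cite: MochizukiEtTh2009, Def 3.3 p.73] -/
theorem constDivInclOf_mem (U : T.Dvᵒᵖ) (x : OrdInt (constFld d T U.unop).K) :
    (constDivInclOf d T A U x : (divisorMonoidsOf d T A hZ).Φ₀.obj U) = (x, 1) := rfl

/-- `constDivInclOf x = (x, 1)`. [cite: MochizukiEtTh2009, Def 3.3 p.73] -/
@[simp] theorem constDivInclOf_apply (U : T.Dvᵒᵖ) (x : OrdInt (constFld d T U.unop).K) : constDivInclOf d T A U x = (x, 1) := rfl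

/-- `constDivInclOf` is injective. [cite: MochizukiEtTh2009, Def 3.3 p.73] -/
theorem constDivInclOf_injective (U : T.Dvᵒᵖ) : Injective (constDivInclOf d T A U) := fun _ _ h => congrArg Prod.fst h

/-- **Naturality of `constDivIncl`**: along `f : U → V` in `𝒟_v̲`, `Φ₀.map f ∘ constDivIncl_U = constDivIncl_V ∘ ord(fixedHom f)` — the
ramification is carried by the genuine field inclusion. [cite: MochizukiEtTh2009, Def 3.3 p.73] -/
theorem constDivInclOf_natural {U V : T.Dvᵒᵖ} (f : U ⟶ V) (x : OrdInt (constFld d T U.unop).K) :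
    ((divisorMonoidsOf d T A hZ).Φ₀.map f).hom (constDivInclOf d T A U x) =
      constDivInclOf d T A V
        (ordIntMapOfHom (d.fieldFunctor.map (T.proj.map f.unop)).alg (d.fieldFunctor.map (T.proj.map f.unop)).isValHom x) := by
  rw [constDivInclOf_apply, divisorMonoidsOf_Φ₀_map_apply, constDivInclOf_apply, map_one]

/-- **The divisor of a genuine constant is its valuation, read through `constDivIncl`**: `div₀ (c, 1) = constDivIncl^gp (ord c)`.
[cite: MochizukiEtTh2009, Def 3.3 p.73] -/
theorem div₀_const (U : T.Dvᵒᵖ) (c : ((constFld d T U.unop).K)ˣ) :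
    (divisorMonoidsOf d T A hZ).div₀ U ((c, 1) : ((constFld d T U.unop).K)ˣ × A.bZero ((cosetGSetFunctor P).obj U.unop)) =
      gpMap (constDivInclOf d T A U) (divUnits (constFld d T U.unop).K c) := by
  rw [divisorMonoidsOf_div₀_apply, map_one, map_one, mul_one]
  rfl

/-- **The constants' divisor submonoid `Φ₀^cnst(U)` of Def. 3.3 (iii) at the engine IS the image of `constDivIncl` composed with the valuation**
(membership form): `div₀` of every element of `(Ω^{aug U})^× × 1 ⊆ F₀(U)` lies in `constDivIncl^gp(ord((Ω^{aug U})^×))`.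
[cite: MochizukiEtTh2009, Def 3.3 p.73] -/
theorem div₀_const_mem_range (U : T.Dvᵒᵖ) (c : ((constFld d T U.unop).K)ˣ) :
    (divisorMonoidsOf d T A hZ).div₀ U ((c, 1) : ((constFld d T U.unop).K)ˣ × A.bZero ((cosetGSetFunctor P).obj U.unop)) ∈
      MonoidHom.range ((gpMap (constDivInclOf d T A U)).comp (divUnits (constFld d T U.unop).K)) :=
  ⟨c, (div₀_const d T A hZ U c).symm⟩

/-- **Prop. 3.4 (ii), first clause, AT THE ENGINE** for every geometric model WITHOUT integral constants (`Z.intConst = ⊥` — the decreed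
theta envelopes): an element of `B₀(U)` with trivial divisor lies in `F₀(U)` (its geometric component is even trivial).
[cite: MochizukiEtTh2009, Prop 3.4 p.74] -/
theorem divisorMonoidsOf_ker_div₀_le_F₀_of_intConst_eq_bot (hZi : Z.intConst = ⊥) (U : T.Dvᵒᵖ)
    (b : (divisorMonoidsOf d T A hZ).B₀.obj U) (hb : (divisorMonoidsOf d T A hZ).div₀ U b = 1) :
    b ∈ (divisorMonoidsOf d T A hZ).F₀ U :=
  DivisorMonoids.prod_ker_div₀_le_F₀ (constDivisorMonoids d T) (geomDivisorMonoids A hZ)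
    (fun _ _ _ => trivial) (fun _ b h => ker_divZeroHom_le_fZero A hZi _ b h) U b hb

/-- **`SpecialFibreCoupling` — the RECORDED RESIDUAL of the ⊕-decoupled type** (RULINGS #334 (2)(c); STATEMENT ONLY): the data under which
print's COUPLED `Φ₀` (div(ϖ_U) = the special fibre `F_U = Σ_j F_j` of the stable model of `Ÿ_U`, [EtTh] §1) is recovered from the engine as
the amalgamated sum `(ord(𝒪^▷_{Ω^{aug U}}) ⊕ Φ₀^geom(U)) / ⟨([ϖ_U], F_U^{-1/e_U})⟩` — a `Π`-compatible, non-trivial, non-cuspidal special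
fibre `F_U ∈ Φ₀^geom(U)` pulled back to itself along every covering map, together with normalised valuations `ord_U : ord(𝒪^▷_{Ω^{aug U}}) ≅ ℕ`
and ramification indices `e_U ≥ 1` with `ord_V(x|_V)·e_U = ord_U(x)·e_V`, so that `[x] ↦ F_U^{ord_U(x)/e_U}` is a NATURAL identification of
the constants' divisors with rational multiples of the special fibre in `Φ₀^geom(U)^pf`.  NOT imposed at the decreed avatar (⊕-DECOUPLED,
FOUNDATIONS 13); a future infinite-tower / stable-model build discharges it.  No theorem here binds it.
[cite: MochizukiEtTh2009, Def 3.3 p.73] -/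
def SpecialFibreCouplingOf : Prop :=
  ∃ (F : ∀ U : T.Dvᵒᵖ, A.phiZero ((cosetGSetFunctor P).obj U.unop))
    (ord : ∀ U : T.Dvᵒᵖ, OrdInt (constFld d T U.unop).K →* Multiplicative ℕ) (e : T.Dvᵒᵖ → ℕ),
    (∀ U, F U ≠ 1 ∧ F U ∈ A.ncspZero ((cosetGSetFunctor P).obj U.unop) ∧ Bijective (ord U) ∧ 0 < e U) ∧
    (∀ {U V : T.Dvᵒᵖ} (f : U ⟶ V), A.phiZeroPull ((cosetGSetFunctor P).map f.unop) (F U) = F V) ∧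
    (∀ {U V : T.Dvᵒᵖ} (f : U ⟶ V) (x : OrdInt (constFld d T U.unop).K),
      Multiplicative.toAdd (ord V (ordIntMapOfHom (d.fieldFunctor.map (T.proj.map f.unop)).alg
          (d.fieldFunctor.map (T.proj.map f.unop)).isValHom x)) * e U =
        Multiplicative.toAdd (ord U x) * e V)

end ArithThetaTower

end Literature.AnabelianGeometry.EtaleTheta

end
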